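import Summits.Ventures.QEC.Census.RankCert
import Summits.Ventures.QEC.Census.CertChunks
import HarnessLib

/-!
# Chunked replay of the rank-certificate checker (CERT-FORMAT v1 §3 `k_cert`, lemma L0 — packable pieces)

`Census/RankCert.lean` (type-02) checks a rank certificate `RC(H) = {r, pivots, rinv, dependent}` in ONE Boolean
`RankCert.check n H c` and proves `check = true → rank (rowMatrix n H) = r` (L0). The dominant cost of a kernel
evaluation (`decide +kernel`) is the `r × r` parity table `|H[pivots[a]] ∩ M_i| ≡ [a = i] (mod 2)`: `r²` pop-counts of
`n`-bit words, i.e. `r² · n` unary steps — fine for the bivariate-bicycle codes up to `n = 144` (`r = 66`: one theorem per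
matrix, ≈ 50 s), too much for one theorem at `n = 288` (`r = 138`: kernel heartbeat budget exceeded, measured
2026-08-26). This file fixes PACKABLE PIECES of the same check, so that a certificate file states a few short
`decide +kernel` theorems and assembles them by a first-order term (same method as `Census/CertChunks.lean` for the
distance checker and `Census/AdditiveCertChunks.lean` for the additive checker):

* `RankCert.structOK H c` — the length / index-range part (`|pivots| = |rinv| = r`, pivots `< |H|`);
* `RankCert.pivotRowOK n H c a` — ROW `a` of the parity table (all `i < r`); `RankCert.pivotRowsOK n H c a0 len` — the
  packed range of rows `a0 ≤ a < a0 + len` in one evaluation;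
* `RankCert.rowsOK H c h0 len` — the packed range of row accounts `rowOK` (`h` is a pivot or XORs from its `dependent`
  entry) for `h0 ≤ h < h0 + len`;
* **assembly** `RankCert.check_of_chunks`: `structOK`, every parity-table row `a < r`, and every row account `h < |H|`
  give `check n H c = true` (hence L0 `rank_rowMatrix_of_check` applies unchanged), with the range bookkeeping lemmas
  `forall_of_pivotRowsOK` / `forall_of_rowsOK` (a passing packed range gives each member) — prefixes are glued with
  `Census.forall_lt_zero` / `forall_lt_append` exactly as for the distance chunks.

Nothing here is specific to a code; no `decide` is run in this file; axioms ⊆ {propext, Classical.choice, Quot.sound}.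
-/

namespace Summit.Ventures.QEC.Census

namespace RankCert

/-! ## Chunk shapes (Bool, evaluated by `decide +kernel` in the certificate files) -/

/-- Structural part of the rank check: `|pivots| = r`, `|rinv| = r`, and every pivot index is a row index of `H`.
(definition) -/
def structOK (H : List ℕ) (c : RankCert) : Bool :=
  (c.pivots.length == c.r) && (c.rinv.length == c.r) && c.pivots.all (fun p => decide (p < H.length))

/-- Row `a` of the parity table: `|H[pivots[a]] ∩ M_i| ≡ [a = i] (mod 2)` for every `i < r`. (definition) -/
def pivotRowOK (n : ℕ) (H : List ℕ) (c : RankCert) (a : ℕ) : Bool :=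
  (List.range c.r).all fun i =>
    popc n (H.getD (c.pivots.getD a 0) 0 &&& c.rinv.getD i 0) % 2 == (if a = i then 1 else 0)

/-- A packed range of parity-table rows: `pivotRowOK n H c a` for `a0 ≤ a < a0 + len`, in one evaluation.
(definition) -/
def pivotRowsOK (n : ℕ) (H : List ℕ) (c : RankCert) (a0 len : ℕ) : Bool :=
  (List.range' a0 len).all (c.pivotRowOK n H)

/-- A packed range of row accounts: `rowOK H c h` for `h0 ≤ h < h0 + len`, in one evaluation. (definition) -/
def rowsOK (H : List ℕ) (c : RankCert) (h0 len : ℕ) : Bool :=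
  (List.range' h0 len).all (c.rowOK H)

/-! ## Assembling lemmas -/

section Assemble

variable {n : ℕ} {H : List ℕ} {c : RankCert}

/-- Unpacking a `List.all` over `List.range'`. -/
private theorem forall_of_all_range' {f : ℕ → Bool} {a len : ℕ} (h : (List.range' a len).all f = true) :
    ∀ i, a ≤ i → i < a + len → f i = true := by
  intro i ha hi
  rw [List.all_eq_true] at h
  exact h i (List.mem_range'_1.2 ⟨ha, hi⟩)

/-- A passing packed range of parity-table rows gives each row in the range. -/
theorem forall_of_pivotRowsOK {a0 len : ℕ} (h : c.pivotRowsOK n H a0 len = true) :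
    ∀ a, a0 ≤ a → a < a0 + len → c.pivotRowOK n H a = true :=
  forall_of_all_range' h

/-- A passing packed range of row accounts gives each row account in the range. -/
theorem forall_of_rowsOK {h0 len : ℕ} (h : c.rowsOK H h0 len = true) :
    ∀ k, h0 ≤ k → k < h0 + len → c.rowOK H k = true :=
  forall_of_all_range' h

/-- The one-shot parity table is the conjunction of its rows. -/
theorem pivotsOK_of_chunks (hs : c.structOK H = true) (hp : ∀ a, a < c.r → c.pivotRowOK n H a = true) :
    c.pivotsOK n H = true := by
  simp only [structOK, Bool.and_eq_true] at hs
  obtain ⟨⟨h1, h2⟩, h3⟩ := hs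
  simp only [pivotsOK, Bool.and_eq_true, h1, h2, h3, true_and, List.all_eq_true, List.mem_range]
  intro a ha
  have h := hp a ha
  simp only [pivotRowOK, List.all_eq_true, List.mem_range] at h
  exact h

/-- **Assembly**: the structural part, every parity-table row `a < r`, and every row account `h < |H|` give the
one-shot rank check `RankCert.check n H c = true` — so L0 (`rank_rowMatrix_of_check`) applies unchanged. -/
theorem check_of_chunks (hs : c.structOK H = true) (hp : ∀ a, a < c.r → c.pivotRowOK n H a = true)
    (hr : ∀ h, h < H.length → c.rowOK H h = true) : c.check n H = true := by
  simp only [check, Bool.and_eq_true, pivotsOK_of_chunks hs hp, true_and, List.all_eq_true, List.mem_range]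
  exact hr

/-- **L0, chunked form**: the pieces give `rank (rowMatrix n H) = r` directly. -/
theorem rank_rowMatrix_of_chunks (hs : c.structOK H = true) (hp : ∀ a, a < c.r → c.pivotRowOK n H a = true)
    (hr : ∀ h, h < H.length → c.rowOK H h = true) : (rowMatrix n H).rank = c.r :=
  rank_rowMatrix_of_check (check_of_chunks hs hp hr)

end Assemble

end RankCert

/-! ## Control (CERT-REQS A1): the `[[4,2,2]]` rank certificate through the chunked form -/

/-- The `[[4,2,2]]` rank certificate `rankCertC422` (`H = [1111]`, `r = 1`) passes the chunked form: structural part,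
the single parity-table row as a packed range of length 1, the single row account as a packed range of length 1, glued
by `forall_lt_zero` / `forall_lt_append` — the shape every large certificate file uses (by `decide`, tier KERNEL). -/
theorem check_rankCertC422_of_chunks : rankCertC422.check 4 [15] = true :=
  RankCert.check_of_chunks (by decide)
    (forall_lt_append forall_lt_zero
      (RankCert.forall_of_pivotRowsOK (n := 4) (H := [15]) (a0 := 0) (len := 1) (by decide)))
    (forall_lt_append forall_lt_zero
      (RankCert.forall_of_rowsOK (H := [15]) (h0 := 0) (len := 1) (by decide)))

end Summit.Ventures.QEC.Census
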